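import Mathlib

/-!
# I3-CRIT-A (abc-iut-crit-A g2) — kernel face of the PRICE (P1) on card `halving-procession-pairing` (O-101)

Over the CARD'S OWN cell currency (`HalvingProcessionPairingSketch.lean`: `cellX`, `cellMargin`,
`placeNetting`, `twistExp`, `labels`, `twistTotalsInvariant_of_ne_zero` — copied verbatim below), the FULL-MASS (all packets kept)
within-place netting of ANY twisted pairing `a ≠ 0` differs from print's (`a = 1`) only through the rounding
terms `x % e ∈ [0, e)`, hence by at most `l⋆ · (e − 1)`:  at the crux's requirement (every packet kept at every
bad place, μ₀ = 1) the twist is INERT up to the rounding bonus — bed: MEETS@1 25/133 · 53/79 · 218/482 vs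
print 25 · 52 · 218 (memo crit-round2-cards-abc-iut-crit-A.md bf91886bbae730e0; kit j295282).
Honesty: a statement about the SPEC's semi-synthetic cell currency, not about IUT; no side on [IUTchIII]
Cor 3.12 (D-0045); typed-and-proved HERE ≠ anything proved about the crux; NOT abc.
-/

set_option linter.dupNamespace false

namespace Summit.ABC.ABC.Cruxes.ThetaPartII.CritA.HalvingInert

open Finset

/-! ## The card's definitions, copied VERBATIM from `HalvingProcessionPairingSketch.lean` (7484ee945859e9bc,
ll. 29–74) — a Cruxes workfile is not an importable farm module, so the copy lives in the sub-namespace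
`CritA`; nothing is altered. -/

/-- [verbatim] Twisted exponent: procession position `j` carries the theta value of exponent `|a·j|_l`. -/
def twistExp (l : ℕ) (a : ZMod l) (j : ℕ) : ℕ := ((a * (j : ZMod l)).valMinAbs).natAbs

/-- [verbatim] The label / packet-position set `{1, …, l⋆}`, `l⋆ = l / 2`. -/
def labels (l : ℕ) : Finset ℕ := Ico 1 (l / 2).succ

/-- [verbatim] totals invariance. -/
def TwistTotalsInvariant (l : ℕ) (a : ZMod l) : Prop :=
  ∀ f : ℕ → ℤ, ∑ j ∈ labels l, f (twistExp l a j) = ∑ j ∈ labels l, f j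

/-- [verbatim, the card's first lemma and proof] -/
theorem twistTotalsInvariant_of_ne_zero (l : ℕ) [Fact l.Prime] (a : ZMod l) (ha : a ≠ 0) :
    TwistTotalsInvariant l a := by
  intro f
  have h := ZMod.Ico_map_valMinAbs_natAbs_eq_Ico_map_id l a ha
  have hm : ((labels l).1.map fun j => f (twistExp l a j)) = ((labels l).1.map fun j => f j) := by
    have h' := congrArg (Multiset.map f) h
    simpa [labels, twistExp, Multiset.map_map, Function.comp_def] using h'
  rw [Finset.sum_eq_multiset_sum, Finset.sum_eq_multiset_sum]
  exact congrArg Multiset.sum hm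

/-- [verbatim] `x = s²·m_q − j·D − (j+1)·R_in`. -/
def cellX (mq D Rin : ℤ) (s j : ℕ) : ℤ := (s : ℤ) ^ 2 * mq - (j : ℤ) * D - ((j : ℤ) + 1) * Rin

/-- [verbatim] `margin = m_q − [e·⌊x/e⌋ + (j+1)·R_out]`. -/
def cellMargin (e mq D Rin Rout : ℤ) (s j : ℕ) : ℤ :=
  mq - (e * (cellX mq D Rin s j / e) + ((j : ℤ) + 1) * Rout)

/-- [verbatim] within-place netting of the kept packets under the pairing `a`. -/
def placeNetting (e mq D Rin Rout : ℤ) (l : ℕ) (a : ZMod l) (keep : Finset ℕ) : ℤ :=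
  ∑ j ∈ keep, cellMargin e mq D Rin Rout (twistExp l a j) j

/-- [verbatim] A pairing `a` with kept set `keep` CLOSES the place iff its netting is nonnegative. -/
def ClosesPlace (e mq D Rin Rout : ℤ) (l : ℕ) (a : ZMod l) (keep : Finset ℕ) : Prop :=
  0 ≤ placeNetting e mq D Rin Rout l a keep

/-! ## Critic's theorems (new) -/

/-- A cell's margin = (pairing-free linear part) − (exponent part `s²·m_q`) + (rounding term `x % e`). -/
theorem cellMargin_eq_linear_add_emod (e mq D Rin Rout : ℤ) (s j : ℕ) :
    cellMargin e mq D Rin Rout s j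
      = (mq + (j : ℤ) * D + ((j : ℤ) + 1) * Rin - ((j : ℤ) + 1) * Rout) - (s : ℤ) ^ 2 * mq
        + cellX mq D Rin s j % e := by
  unfold cellMargin
  have h := Int.emod_add_ediv_mul (cellX mq D Rin s j) e
  have h' : e * (cellX mq D Rin s j / e) = cellX mq D Rin s j - cellX mq D Rin s j % e := by
    rw [mul_comm]; linarith
  rw [h']
  unfold cellX
  ring

/-- FULL-MASS netting: twist minus print = difference of the rounding sums (everything else cancels by the
card's totals invariance applied to `s ↦ s²·m_q`). -/
theorem placeNetting_allKept_twist_sub_print (e mq D Rin Rout : ℤ) (l : ℕ) [Fact l.Prime]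
    (a : ZMod l) (ha : a ≠ 0) :
    placeNetting e mq D Rin Rout l a (labels l) - placeNetting e mq D Rin Rout l 1 (labels l)
      = ∑ j ∈ labels l, cellX mq D Rin (twistExp l a j) j % e
        - ∑ j ∈ labels l, cellX mq D Rin (twistExp l 1 j) j % e := by
  unfold placeNetting
  rw [← Finset.sum_sub_distrib]
  have hterm : ∀ j ∈ labels l,
      cellMargin e mq D Rin Rout (twistExp l a j) j - cellMargin e mq D Rin Rout (twistExp l 1 j) j
        = (-((twistExp l a j : ℤ) ^ 2 * mq) + cellX mq D Rin (twistExp l a j) j % e)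
          - (-((twistExp l 1 j : ℤ) ^ 2 * mq) + cellX mq D Rin (twistExp l 1 j) j % e) := by
    intro j _
    rw [cellMargin_eq_linear_add_emod, cellMargin_eq_linear_add_emod]
    ring
  rw [Finset.sum_congr rfl hterm, Finset.sum_sub_distrib, Finset.sum_add_distrib, Finset.sum_add_distrib,
    Finset.sum_neg_distrib, Finset.sum_neg_distrib]
  have h1 := twistTotalsInvariant_of_ne_zero l a ha (fun s => (s : ℤ) ^ 2 * mq)
  have h2 := twistTotalsInvariant_of_ne_zero l 1 one_ne_zero (fun s => (s : ℤ) ^ 2 * mq)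
  linarith

/-- each rounding sum lies in `[0, l⋆·(e−1)]` (`l⋆ = l/2 = #labels`). -/
theorem roundingSum_bounds (e mq D Rin : ℤ) (he : 0 < e) (l : ℕ) (b : ZMod l) :
    0 ≤ ∑ j ∈ labels l, cellX mq D Rin (twistExp l b j) j % e ∧
      ∑ j ∈ labels l, cellX mq D Rin (twistExp l b j) j % e ≤ ((l / 2 : ℕ) : ℤ) * (e - 1) := by
  refine ⟨Finset.sum_nonneg fun j _ => Int.emod_nonneg _ he.ne', ?_⟩
  calc ∑ j ∈ labels l, cellX mq D Rin (twistExp l b j) j % e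
      ≤ ∑ _j ∈ labels l, (e - 1) := Finset.sum_le_sum fun j _ => by
          have := Int.emod_lt_of_pos (cellX mq D Rin (twistExp l b j) j) he
          omega
    _ = ((l / 2 : ℕ) : ℤ) * (e - 1) := by
          simp [labels, Finset.sum_const, Nat.card_Ico]
          ring

/-- **Kernel face of PRICE (P1): INERT AT FULL MASS up to the rounding bonus.**  For `l` prime, any twist
`a ≠ 0` and any place data with `e > 0`:
`|netting_allKept(a) − netting_allKept(print)| ≤ l⋆ · (e − 1)`. -/
theorem abs_placeNetting_allKept_twist_sub_print_le (e mq D Rin Rout : ℤ) (he : 0 < e) (l : ℕ)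
    [Fact l.Prime] (a : ZMod l) (ha : a ≠ 0) :
    |placeNetting e mq D Rin Rout l a (labels l) - placeNetting e mq D Rin Rout l 1 (labels l)|
      ≤ ((l / 2 : ℕ) : ℤ) * (e - 1) := by
  rw [placeNetting_allKept_twist_sub_print e mq D Rin Rout l a ha]
  obtain ⟨h1, h2⟩ := roundingSum_bounds e mq D Rin he l a
  obtain ⟨h3, h4⟩ := roundingSum_bounds e mq D Rin he l 1
  rw [abs_le]
  constructor <;> linarith

/-- In particular a twist can flip full-mass closure only at places where print's all-kept netting is within
the rounding bonus of zero: if print misses by more than `l⋆(e−1)`, so does every twist. -/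
theorem not_closes_allKept_of_print_deficit (e mq D Rin Rout : ℤ) (he : 0 < e) (l : ℕ) [Fact l.Prime]
    (a : ZMod l) (ha : a ≠ 0)
    (hdef : placeNetting e mq D Rin Rout l 1 (labels l) + ((l / 2 : ℕ) : ℤ) * (e - 1) < 0) :
    ¬ ClosesPlace e mq D Rin Rout l a (labels l) := by
  unfold ClosesPlace
  have h := abs_placeNetting_allKept_twist_sub_print_le e mq D Rin Rout he l a ha
  rw [abs_le] at h
  linarith [h.2]

/-- Worked place of the card (FREY133, p = 7, l = 107): print's full-mass deficit −1 332 482 exceeds the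
rounding bonus 53 · 1604 = 85 012 by far, so NO twist closes it at full mass (the card's halving twist closes
only after DROPPING packets {1,3,5}, i.e. at kept share 0.841 < 1). -/
theorem printNetting_FREY_p7_l107 : placeNetting 1605 210 1604 268 (-4472) 107 1 (labels 107) = -1332482 := by
  native_decide

example : ∀ a : ZMod 107, a ≠ 0 → ¬ ClosesPlace 1605 210 1604 268 (-4472) 107 a (labels 107) := by
  haveI : Fact (Nat.Prime 107) := ⟨by norm_num⟩
  intro a ha
  refine not_closes_allKept_of_print_deficit 1605 210 1604 268 (-4472) (by norm_num) 107 a ha ?_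
  rw [printNetting_FREY_p7_l107]; norm_num

end Summit.ABC.ABC.Cruxes.ThetaPartII.CritA.HalvingInert
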